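import Summits.ResolutionOfSingularities.ResolutionOfSingularities.Theorems.FrobeniusLadderFRationalResolutionGradedLocalPrincipal
import Mathlib.RingTheory.Ideal.Maps
import HarnessLib

/-!
# Crux `FrobeniusLadder.FRationalResolution` (stmt-ResolutionOfSingularities-15317), line `redirect`,
# stub `stub_diagonalizableQuotientResolution` — THE NON-PRINCIPAL DIVISORIAL WITNESS `I₀ = dA ∩ R`
# (the `I₀` slot of `…CompletionDomain.hloc_of_traceIdealCentre_then_finite_singularPoints_of_isIntegrallyClosed`, p840173)

For `R → A` injective with `A ∩ Frac R = R` (e.g. `R = κ[[y]]₀ ⊆ A = κ[[y]]`), an element `d ∈ A` (think `d = y₁`, weight `w`), an exponent with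
`d^{n+1} ∈ R` and a «coprime partner» `e` with `dⁿe ∈ R` and `d ∣ e x ⇒ d ∣ x` (think `e` = a monomial of weight `w` prime to `y₁`):

* `mem_comap_span_singleton_iff` — the contracted ideal `I₀ = {x ∈ R : d ∣ x}` is `{x : (dⁿe)·x ∈ d^{n+1} R}`;
* ★ `divisorial_comap_span_singleton` — hence `I₀` is a NONZERO DIVISORIAL (v-) ideal of `R` (the v-test against the single pair `(d^{n+1}, dⁿe)`);
* ★ `exists_dvd_of_comap_span_singleton_eq_span` — if `I₀ = (x₀)` were principal then `s₀ = x₀/d` divides every `s` with `d s ∈ R`, i.e. (graded case,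
  `…GradedLocalPrincipal.mul_mem_grade_zero_iff`) every element of `𝒜 (−w)`: `forall_dvd_of_grade_of_principal` — refuted in each class by two coprime
  monomials of weight `−w`.

Honest label: elementary algebra toward ONE leaf stub (no stub, crux or summit closed). No definitions, no named facts, no sorry. [folklore; cite: Matsumura1987, §11]
-/

-- single-problem summit: the doubled namespace component is forced
set_option linter.dupNamespace false

open DirectSum SetLike
open Summit.ResolutionOfSingularities.ResolutionOfSingularities.Theorems.FRationalResolution

namespace Summit.ResolutionOfSingularities.ResolutionOfSingularities.Theorems.FRationalResolution.ContractedPrincipalDivisorial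

universe u

/-! ## §1 The contracted principal ideal `dA ∩ R` -/

section Ring

variable {R A : Type u} [CommRing R] [CommRing A] [IsDomain A] [Algebra R A]

/-- **`{x ∈ R : d ∣ x} = {x : (dⁿe) x ∈ d^{n+1} R}`.** [folklore] -/
theorem mem_comap_span_singleton_iff (hinj : Function.Injective (algebraMap R A))
    (hFrac : ∀ (x : A) (r₁ r₂ : R), r₂ ≠ 0 → algebraMap R A r₂ * x = algebraMap R A r₁ → ∃ r : R, algebraMap R A r = x)
    {d e : A} (hd0 : d ≠ 0) {n : ℕ} {c₀ b₀ : R} (hc : algebraMap R A c₀ = d ^ (n + 1)) (hb : algebraMap R A b₀ = d ^ n * e)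
    (hcop : ∀ x : A, d ∣ e * x → d ∣ x) (x : R) :
    x ∈ (Ideal.span {d}).comap (algebraMap R A) ↔ b₀ * x ∈ Ideal.span ({c₀} : Set R) := by
  have hc0 : c₀ ≠ 0 := fun h => by
    rw [h, map_zero] at hc
    exact pow_ne_zero _ hd0 hc.symm
  rw [Ideal.mem_comap, Ideal.mem_span_singleton, Ideal.mem_span_singleton']
  constructor
  · rintro ⟨t, ht⟩
    -- `b₀ x = c₀ · (e t)` in `A`, and `e t ∈ R`
    have h1 : algebraMap R A c₀ * (e * t) = algebraMap R A (b₀ * x) := by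
      rw [map_mul, hb, ht, hc]
      ring
    obtain ⟨r, hr⟩ := hFrac (e * t) (b₀ * x) c₀ hc0 h1
    refine ⟨r, hinj ?_⟩
    rw [map_mul, hr, mul_comm, h1]
  · rintro ⟨r, hr⟩
    apply hcop
    -- `dⁿ (e x) = dⁿ (d r)`
    have h1 : d ^ n * (e * algebraMap R A x) = d ^ n * (d * algebraMap R A r) := by
      have h2 := congrArg (algebraMap R A) hr
      rw [map_mul, map_mul, hb, hc] at h2
      calc d ^ n * (e * algebraMap R A x) = d ^ n * e * algebraMap R A x := by ring
        _ = algebraMap R A r * d ^ (n + 1) := h2.symm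
        _ = d ^ n * (d * algebraMap R A r) := by ring
    exact ⟨algebraMap R A r, mul_left_cancel₀ (pow_ne_zero n hd0) h1⟩

/-- ★ **`I₀ = dA ∩ R` is a nonzero divisorial ideal of `R`.** [folklore; cite: Matsumura1987, §11] -/
theorem divisorial_comap_span_singleton (hinj : Function.Injective (algebraMap R A))
    (hFrac : ∀ (x : A) (r₁ r₂ : R), r₂ ≠ 0 → algebraMap R A r₂ * x = algebraMap R A r₁ → ∃ r : R, algebraMap R A r = x)
    {d e : A} (hd0 : d ≠ 0) {n : ℕ} {c₀ b₀ : R} (hc : algebraMap R A c₀ = d ^ (n + 1)) (hb : algebraMap R A b₀ = d ^ n * e)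
    (hcop : ∀ x : A, d ∣ e * x → d ∣ x) :
    (Ideal.span {d}).comap (algebraMap R A) ≠ ⊥ ∧
      ∀ x : R, (∀ c b : R, (∀ y ∈ (Ideal.span {d}).comap (algebraMap R A), b * y ∈ Ideal.span ({c} : Set R)) →
        b * x ∈ Ideal.span ({c} : Set R)) → x ∈ (Ideal.span {d}).comap (algebraMap R A) := by
  have hmem := mem_comap_span_singleton_iff hinj hFrac hd0 hc hb hcop
  refine ⟨fun h => ?_, fun x hx => ?_⟩
  · have hc₀ : c₀ ∈ (Ideal.span {d}).comap (algebraMap R A) := by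
      rw [Ideal.mem_comap, hc, Ideal.mem_span_singleton]
      exact dvd_pow_self d (Nat.succ_ne_zero n)
    rw [h, Ideal.mem_bot] at hc₀
    rw [hc₀, map_zero] at hc
    exact pow_ne_zero _ hd0 hc.symm
  · exact (hmem x).mpr (hx c₀ b₀ fun y hy => (hmem y).mp hy)

/-- ★ **Principality test.** If `dA ∩ R = (x₀)` then `s₀ = x₀ / d` divides every `s ∈ A` with `d s ∈ R`. [folklore] -/
theorem exists_dvd_of_comap_span_singleton_eq_span {d : A} (hd0 : d ≠ 0) {x₀ : R}
    (hI : (Ideal.span {d}).comap (algebraMap R A) = Ideal.span {x₀}) :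
    ∃ s₀ : A, algebraMap R A x₀ = d * s₀ ∧ ∀ (s : A) (x : R), algebraMap R A x = d * s → s₀ ∣ s := by
  have hx₀ : x₀ ∈ (Ideal.span {d}).comap (algebraMap R A) := hI ▸ Ideal.mem_span_singleton_self x₀
  rw [Ideal.mem_comap, Ideal.mem_span_singleton] at hx₀
  obtain ⟨s₀, hs₀⟩ := hx₀
  refine ⟨s₀, hs₀, fun s x hxs => ?_⟩
  have hx : x ∈ (Ideal.span {d}).comap (algebraMap R A) := by
    rw [Ideal.mem_comap, Ideal.mem_span_singleton]
    exact ⟨s, hxs⟩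
  rw [hI, Ideal.mem_span_singleton'] at hx
  obtain ⟨t, rfl⟩ := hx
  refine ⟨algebraMap R A t, mul_left_cancel₀ hd0 ?_⟩
  rw [← hxs, map_mul, hs₀]
  ring

end Ring

/-! ## §2 Graded reading: a principal `I₀` would give a common divisor of `𝒜 (−w)` -/

/-- **Graded principality test.** `A` a graded domain, `R → 𝒜 0` with image all of `𝒜 0`, `0 ≠ d ∈ 𝒜 w`: if `dA ∩ R` is principal then some
`s₀ ∈ 𝒜 (−w)` divides every element of `𝒜 (−w)`. [folklore] -/
theorem forall_dvd_of_grade_of_principal {ι σ : Type*} {A : Type u} [CommRing A] [IsDomain A] [SetLike σ A] [AddSubmonoidClass σ A]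
    (𝒜 : ι → σ) [DecidableEq ι] [AddCommGroup ι] [GradedRing 𝒜]
    {R : Type u} [CommRing R] [Algebra R A] (hR0 : ∀ r : R, algebraMap R A r ∈ 𝒜 0)
    (hR0' : ∀ a : A, a ∈ 𝒜 0 → ∃ r : R, algebraMap R A r = a)
    {w : ι} {d : A} (hd : d ∈ 𝒜 w) (hd0 : d ≠ 0) {x₀ : R} (hI : (Ideal.span {d}).comap (algebraMap R A) = Ideal.span {x₀}) :
    ∃ s₀ : A, s₀ ∈ 𝒜 (-w) ∧ ∀ s : A, s ∈ 𝒜 (-w) → s₀ ∣ s := by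
  obtain ⟨s₀, hs₀, hdiv⟩ := exists_dvd_of_comap_span_singleton_eq_span hd0 hI
  refine ⟨s₀, (GradedLocalPrincipal.mul_mem_grade_zero_iff 𝒜 hd hd0 s₀).mp (hs₀ ▸ hR0 x₀), fun s hs => ?_⟩
  obtain ⟨x, hx⟩ := hR0' _ ((GradedLocalPrincipal.mul_mem_grade_zero_iff 𝒜 hd hd0 s).mpr hs)
  exact hdiv s x hx

end Summit.ResolutionOfSingularities.ResolutionOfSingularities.Theorems.FRationalResolution.ContractedPrincipalDivisorial
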